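import Literature.MeasureTheory.RandomSets.MeasurableSelectionCompact

/-!
# Measurable selection of constrained minimisers: open class, closed constraint, piecewise-continuous constraint map

Topic `Literature/MeasureTheory/RandomSets` (sibling of `MeasurableSelectionCompact`).  Pure Mathlib.

SETTING.  `Y` a compact Polish (= compact metrisable) space with its Borel σ-algebra, `S : Y → ℝ` continuous, `O ⊆ Y` open, `Z` a topological space whose σ-algebra
contains the open sets, `R ⊆ Z × Z` closed, `π : X → Z` a measurable map on a measurable space of parameters, and `g : Y → Z` a map that is
continuous on each member of a countable CLOSED cover of `Y` (`SigmaClosedContinuous` — e.g. a map defined by cases on an open guard,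
continuous on the guard and on its complement; such maps are closed under finite products and composition).  The constrained problem at the
parameter `x` is `min { S y | y ∈ O, (g y, π x) ∈ R }`.

* `SigmaClosedContinuous` with `of_continuous`, `of_isOpen` (two pieces), `pi` (finite products), `comp` (composition);
* `isCompact_constraint`, `isHitMeasurable_constraint` — for `C` closed with `g` continuous on `C`, the correspondence `x ↦ {y ∈ C | (g y, π x) ∈ R}`
  is compact-valued and hit-measurable (its hit sets are preimages under `π` of projections along the compact factor of closed subsets of
  `Y × Z`, `isClosedMap_snd_of_compactSpace`);
* `exists_measurable_constrained_argmin` — **there is a measurable `f : X → Y` which, at every parameter at which the constrained problem HAS a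
  minimiser, is such a minimiser** (default value elsewhere): the admissible set is the countable union of the compact-valued hit-measurable
  pieces `{y ∈ K_n ∩ C_m | (g y, π x) ∈ R}` (`K_n` a closed exhaustion of `O`, `C_m` the pieces of `g`), and
  `exists_measurable_argmin_selector_iUnion` applies.

(Use: the (2.12) background-field minimisation of [Balaban1988Convergent] p. 256 — Wilson action over a product of `SU(N)`'s, small-plaquette
class, block averages prescribed on a determining set, the exp-mean-log block averaging being continuous only piecewise —
`Node00/Record12MinimiserSelection`.)
HONEST FRAMING: textbook topology ∕ measure theory, kernel-checked; nothing of Bałaban's series is asserted here; no carrier of record is touched.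
-/

noncomputable section

open Set
open _root_.MeasureTheory _root_.TopologicalSpace

namespace Literature.MeasureTheory.RandomSets

/-! ## §1 Maps continuous on the members of a countable closed cover -/

section Pieces

variable {Y Y' Y'' : Type*} [TopologicalSpace Y] [TopologicalSpace Y'] [TopologicalSpace Y'']

/-- `f` is continuous on each member of some countable cover of its domain by CLOSED sets (e.g. a map defined by cases on an open guard, continuous
on the guard and on its complement) — the hypothesis under which the closed-graph argument of [RobinsonRodrigoSadowskiCUP2016] Lemma E.2 applies
piece by piece. [cite: RobinsonRodrigoSadowskiCUP2016, Lemma E.2 p.304 (bookkeeping: piecewise form)] -/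
def SigmaClosedContinuous (f : Y → Y') : Prop :=
  ∃ C : ℕ → Set Y, (∀ m, IsClosed (C m)) ∧ (∀ y, ∃ m, y ∈ C m) ∧ ∀ m, ContinuousOn f (C m)

namespace SigmaClosedContinuous

/-- Constructor from a cover indexed by any countable non-empty type. [folklore] -/
private theorem of_countable {ι : Type*} [Countable ι] [Nonempty ι] {f : Y → Y'} (C : ι → Set Y) (hcl : ∀ i, IsClosed (C i))
    (hcov : ∀ y, ∃ i, y ∈ C i) (hcont : ∀ i, ContinuousOn f (C i)) : SigmaClosedContinuous f := by
  obtain ⟨e, he⟩ := exists_surjective_nat ι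
  refine ⟨fun m => C (e m), fun m => hcl _, fun y => ?_, fun m => hcont _⟩
  obtain ⟨i, hi⟩ := hcov y
  obtain ⟨m, rfl⟩ := he i
  exact ⟨m, hi⟩

/-- A continuous map is σ-closed-continuous (one piece). [cite: RobinsonRodrigoSadowskiCUP2016, Lemma E.2 p.304 (bookkeeping: piecewise form)] -/
theorem of_continuous {f : Y → Y'} (hf : Continuous f) : SigmaClosedContinuous f :=
  ⟨fun _ => univ, fun _ => isClosed_univ, fun _ => ⟨0, mem_univ _⟩, fun _ => hf.continuousOn⟩

/-- TWO PIECES: on a metrisable space, a map continuous on an open set `O` and on its complement is σ-closed-continuous (the open set is a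
countable union of closed sets). [cite: RobinsonRodrigoSadowskiCUP2016, Lemma E.2 p.304 (bookkeeping: piecewise form)] -/
theorem of_isOpen [MetrizableSpace Y] {f : Y → Y'} {O : Set Y} (hO : IsOpen O) (h₁ : ContinuousOn f O) (h₂ : ContinuousOn f Oᶜ) :
    SigmaClosedContinuous f := by
  letI : MetricSpace Y := TopologicalSpace.metrizableSpaceMetric Y
  obtain ⟨F, hFcl, hFsub, hFU, -⟩ := hO.exists_iUnion_isClosed
  refine of_countable (ι := Option ℕ) (fun o => o.elim Oᶜ F) (fun o => ?_) (fun y => ?_) (fun o => ?_)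
  · cases o with
    | none => exact hO.isClosed_compl
    | some m => exact hFcl m
  · by_cases hy : y ∈ O
    · rw [← hFU] at hy
      obtain ⟨m, hm⟩ := mem_iUnion.mp hy
      exact ⟨some m, hm⟩
    · exact ⟨none, hy⟩
  · cases o with
    | none => exact h₂
    | some m => exact h₁.mono (hFsub m)

/-- FINITE PRODUCTS: if every coordinate map is σ-closed-continuous, so is the map into the product (pieces: intersections of one piece per
coordinate). [cite: RobinsonRodrigoSadowskiCUP2016, Lemma E.2 p.304 (bookkeeping: piecewise form)] -/
theorem pi {ι : Type*} [Finite ι] {Z : ι → Type*} [∀ i, TopologicalSpace (Z i)] {f : ∀ i, Y → Z i}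
    (hf : ∀ i, SigmaClosedContinuous (f i)) : SigmaClosedContinuous fun y i => f i y := by
  choose C hcl hcov hcont using hf
  refine of_countable (ι := ι → ℕ) (fun s => ⋂ i, C i (s i)) (fun s => isClosed_iInter fun i => hcl i (s i))
    (fun y => ?_) (fun s => ?_)
  · choose m hm using fun i => hcov i y
    exact ⟨m, mem_iInter.mpr hm⟩
  · exact continuousOn_pi.mpr fun i => (hcont i (s i)).mono (iInter_subset _ i)

/-- COMPOSITION: σ-closed-continuous maps compose (pieces `C_m ∩ f⁻¹(C'_{m'})`, closed because `f` is continuous on the closed `C_m`).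
[cite: RobinsonRodrigoSadowskiCUP2016, Lemma E.2 p.304 (bookkeeping: piecewise form)] -/
theorem comp {f : Y → Y'} {g : Y' → Y''} (hg : SigmaClosedContinuous g) (hf : SigmaClosedContinuous f) :
    SigmaClosedContinuous (g ∘ f) := by
  obtain ⟨C, hCcl, hCcov, hCcont⟩ := hf
  obtain ⟨C', hC'cl, hC'cov, hC'cont⟩ := hg
  refine of_countable (ι := ℕ × ℕ) (fun p => C p.1 ∩ f ⁻¹' C' p.2)
    (fun p => (hCcont p.1).preimage_isClosed_of_isClosed (hCcl p.1) (hC'cl p.2)) (fun y => ?_) (fun p => ?_)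
  · obtain ⟨m, hm⟩ := hCcov y
    obtain ⟨m', hm'⟩ := hC'cov (f y)
    exact ⟨(m, m'), hm, hm'⟩
  · exact (hC'cont p.2).comp ((hCcont p.1).mono inter_subset_left) fun y hy => hy.2

end SigmaClosedContinuous

end Pieces

/-! ## §2 The constraint correspondence `x ↦ {y ∈ C | (g y, π x) ∈ R}` -/

section Constraint

variable {X Y Z : Type*} [MeasurableSpace X] [TopologicalSpace Y] [TopologicalSpace Z]

omit [MeasurableSpace X] in
/-- Compact values: for `C` closed in a compact space and `g` continuous on `C`, `{y ∈ C | (g y, z) ∈ R}` is compact (`R` closed).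
[cite: RobinsonRodrigoSadowskiCUP2016, Cor E.3 p.304 (bookkeeping)] -/
theorem isCompact_constraint [CompactSpace Y] {C : Set Y} (hC : IsClosed C) {g : Y → Z} (hg : ContinuousOn g C)
    {R : Set (Z × Z)} (hR : IsClosed R) (z : Z) : IsCompact {y | y ∈ C ∧ (g y, z) ∈ R} := by
  have h : IsClosed (C ∩ (fun y => (g y, z)) ⁻¹' R) :=
    (hg.prodMk continuousOn_const).preimage_isClosed_of_isClosed hC hR
  exact h.isCompact

/-- **Hit-measurability of the constraint correspondence**: for `C` closed in a COMPACT space `Y`, `g` continuous on `C`, `R ⊆ Z × Z` closed and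
`π : X → Z` measurable (`Z` with a σ-algebra containing the open sets), `x ↦ {y ∈ C | (g y, π x) ∈ R}` is hit-measurable: its `F`-hitting set is
the `π`-preimage of the projection along the compact factor `Y` of a closed subset of `Y × Z`, and that projection is closed — the argument of
[RobinsonRodrigoSadowskiCUP2016] Lemma E.2 (`Λ⁻¹(A) = P((X × A) ∩ 𝒢)` closed) composed with the measurable data map. [cite: RobinsonRodrigoSadowskiCUP2016, Lemma E.2 p.304] -/
theorem isHitMeasurable_constraint [CompactSpace Y] [MeasurableSpace Z] [OpensMeasurableSpace Z] {π : X → Z} (hπ : Measurable π)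
    {C : Set Y} (hC : IsClosed C) {g : Y → Z} (hg : ContinuousOn g C) {R : Set (Z × Z)} (hR : IsClosed R) :
    IsHitMeasurable fun x => {y | y ∈ C ∧ (g y, π x) ∈ R} := by
  intro F hF
  set T : Set (Y × Z) := {p | p.1 ∈ C ∩ F ∧ (g p.1, p.2) ∈ R} with hT
  have hTcl : IsClosed T := by
    have hcont : ContinuousOn (fun p : Y × Z => (g p.1, p.2)) ((C ∩ F) ×ˢ univ) :=
      ((hg.mono inter_subset_left).comp continuousOn_fst fun p hp => hp.1).prodMk continuousOn_snd
    have e : T = (C ∩ F) ×ˢ univ ∩ (fun p : Y × Z => (g p.1, p.2)) ⁻¹' R := by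
      ext p; simp [hT, mem_prod]
    rw [e]
    exact hcont.preimage_isClosed_of_isClosed ((hC.inter hF).prod isClosed_univ) hR
  have himg : IsClosed (Prod.snd '' T) := isClosedMap_snd_of_compactSpace T hTcl
  have key : {x | ({y | y ∈ C ∧ (g y, π x) ∈ R} ∩ F).Nonempty} = π ⁻¹' (Prod.snd '' T) := by
    ext x
    constructor
    · rintro ⟨y, ⟨hyC, hyR⟩, hyF⟩
      exact ⟨(y, π x), ⟨⟨hyC, hyF⟩, hyR⟩, rfl⟩
    · rintro ⟨⟨y, z⟩, ⟨⟨hyC, hyF⟩, hyR⟩, hz⟩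
      simp only at hz
      subst hz
      exact ⟨y, ⟨hyC, hyR⟩, hyF⟩
  rw [key]
  exact hπ himg.measurableSet

end Constraint

/-! ## §3 Measurable argmin under an open class and a closed constraint -/

section ConstrainedArgmin

variable {X Y Z : Type*} [MeasurableSpace X] [TopologicalSpace Y] [PolishSpace Y] [CompactSpace Y]
  [MeasurableSpace Y] [BorelSpace Y] [TopologicalSpace Z] [MeasurableSpace Z] [OpensMeasurableSpace Z]

/-- **MEASURABLE SELECTION OF CONSTRAINED MINIMISERS.**  `Y` compact Polish (= compact metrisable; Borel σ-algebra), `O ⊆ Y` open, `S : Y → ℝ` continuous,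
`g : Y → Z` σ-closed-continuous, `R ⊆ Z × Z` closed, `π : X → Z` measurable.  Then there is a MEASURABLE `f : X → Y` such that, for every `x`
at which the problem `min {S y | y ∈ O, (g y, π x) ∈ R}` has a minimiser, `f x` is one, and `f x = y₀` at every other `x`.  (The admissible set is the
countable union of the compact-valued hit-measurable pieces `{y ∈ K_n ∩ C_m | (g y, π x) ∈ R}`, `K_n` a closed exhaustion of `O`, `C_m` the pieces
of `g`; then `exists_measurable_argmin_selector_iUnion`.)  The measurable maximum theorem [AliprantisBorder2006] Thm 18.19 in the piecewise
closed-graph setting of [RobinsonRodrigoSadowskiCUP2016] Cor E.3. [cite: AliprantisBorder2006, Thm 18.19 p.605] -/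
theorem exists_measurable_constrained_argmin {π : X → Z} (hπ : Measurable π) {g : Y → Z} (hg : SigmaClosedContinuous g)
    {O : Set Y} (hO : IsOpen O) {R : Set (Z × Z)} (hR : IsClosed R) {S : Y → ℝ} (hS : Continuous S) (y₀ : Y) :
    ∃ f : X → Y, Measurable f ∧
      (∀ x, (∃ y, (y ∈ O ∧ (g y, π x) ∈ R) ∧ ∀ z, z ∈ O ∧ (g z, π x) ∈ R → S y ≤ S z) →
        (f x ∈ O ∧ (g (f x), π x) ∈ R) ∧ ∀ z, z ∈ O ∧ (g z, π x) ∈ R → S (f x) ≤ S z) ∧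
      (∀ x, ¬ (∃ y, (y ∈ O ∧ (g y, π x) ∈ R) ∧ ∀ z, z ∈ O ∧ (g z, π x) ∈ R → S y ≤ S z) → f x = y₀) := by
  letI mY : MetricSpace Y := TopologicalSpace.metrizableSpaceMetric Y
  obtain ⟨K, hKcl, hKsub, hKU, -⟩ := hO.exists_iUnion_isClosed
  obtain ⟨C, hCcl, hCcov, hCcont⟩ := hg
  let D : ℕ → X → Set Y := fun k x =>
    {y | y ∈ K (Nat.unpair k).1 ∩ C (Nat.unpair k).2 ∧ (g y, π x) ∈ R}
  have hDc : ∀ k x, IsCompact (D k x) := fun k x =>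
    isCompact_constraint ((hKcl _).inter (hCcl _)) ((hCcont _).mono inter_subset_right) hR (π x)
  have hDm : ∀ k, IsHitMeasurable (D k) := fun k =>
    isHitMeasurable_constraint hπ ((hKcl _).inter (hCcl _)) ((hCcont _).mono inter_subset_right) hR
  have hDU : ∀ x y, y ∈ (⋃ k, D k x) ↔ y ∈ O ∧ (g y, π x) ∈ R := by
    intro x y
    constructor
    · intro hy
      obtain ⟨k, ⟨hyK, -⟩, hyR⟩ := mem_iUnion.mp hy
      exact ⟨hKsub _ hyK, hyR⟩
    · rintro ⟨hyO, hyR⟩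
      rw [← hKU] at hyO
      obtain ⟨n, hn⟩ := mem_iUnion.mp hyO
      obtain ⟨m, hm⟩ := hCcov y
      refine mem_iUnion.mpr ⟨Nat.pair n m, ?_, hyR⟩
      rw [Nat.unpair_pair]
      exact ⟨hn, hm⟩
  obtain ⟨f, hfm, hfin, hfout⟩ := exists_measurable_argmin_selector_iUnion D hDc hDm hS y₀
  refine ⟨f, hfm, fun x hx => ?_, fun x hx => ?_⟩
  · obtain ⟨y, hy, hmin⟩ := hx
    have hx' : ∃ y ∈ ⋃ k, D k x, ∀ z ∈ ⋃ k, D k x, S y ≤ S z :=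
      ⟨y, (hDU x y).mpr hy, fun z hz => hmin z ((hDU x z).mp hz)⟩
    obtain ⟨hf₁, hf₂⟩ := hfin x hx'
    exact ⟨(hDU x _).mp hf₁, fun z hz => hf₂ z ((hDU x z).mpr hz)⟩
  · refine hfout x fun h => hx ?_
    obtain ⟨y, hy, hmin⟩ := h
    exact ⟨y, (hDU x y).mp hy, fun z hz => hmin z ((hDU x z).mpr hz)⟩

end ConstrainedArgmin

end Literature.MeasureTheory.RandomSets
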